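/-
Origin: expansion seat `prover-pub-hodgecm-mc-binder-1-g16-0`, handover #R108 2026-08-20T20:18:19Z md5 593e8aa6c59f (401 l.; NEW additive MODEL leaf; imports #R107 HodgeCM.Model.LevelTranslate + #R106 HodgeCM.Model.LevelConjugate only; install after both; drop-alone below them; NAME LIST: HodgeCM.Model.TowerLevel.ρ · HodgeCM.Model.TowerLevel.Coh · HodgeCM.Model.TowerLevel.trPull · HodgeCM.Model.TowerLevel.trPull_trPull · HodgeCM.Model.TowerLevel.trPull_one_self · HodgeCM.Model.TowerLevel.trPull_one_apply_of_eq · HodgeCM.Model.TowerLevel.transCond_one_of_eq · HodgeCM.Model.TowerLevel.transCond_one_of_le · HodgeCM.Model.TowerLevel.transCond_one_comp · HodgeCM.Model.TowerLevel.transCond_comp_one · HodgeCM.Model.TowerLevel.Rel · HodgeCM.Model.TowerLevel.Rel.one_of_mem · HodgeCM.Model.TowerLevel.Rel.refl · HodgeCM.Model.TowerLevel.Rel.self · HodgeCM.Model.TowerLevel.Rel.of_le · HodgeCM.Model.TowerLevel.conj_Γ_eq_of_rel · HodgeCM.Model.TowerLevel.transCond_of_rel · HodgeCM.Model.TowerLevel.W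 · HodgeCM.Model.TowerLevel.towerLevel · HodgeCM.Model.TowerLevel.mem_towerLevel_iff · HodgeCM.Model.TowerLevel.apply_eq_trPull · HodgeCM.Model.TowerLevel.apply_eq_of_mem · HodgeCM.Model.TowerLevel.res · HodgeCM.Model.TowerLevel.res_apply · HodgeCM.Model.TowerLevel.transCond_conj_of_le · HodgeCM.Model.TowerLevel.restrictLevel · HodgeCM.Model.TowerLevel.restrictLevel_apply · HodgeCM.Model.TowerLevel.res_restrictLevel · HodgeCM.Model.TowerLevel.restrictLevel_refl · HodgeCM.Model.TowerLevel.restrictLevel_trans · HodgeCM.Model.TowerLevel.castLevel · HodgeCM.Model.TowerLevel.castLevel_apply · HodgeCM.Model.TowerLevel.castLevel_rfl · HodgeCM.Model.TowerLevel.castLevel_castLevel_symm · HodgeCM.Model.TowerLevel.castLevel_trans · HodgeCM.Model.TowerLevel.rel_mul_of_rel_conj · HodgeCM.Model.TowerLevel.transCond_conj_conj · HodgeCM.Model.TowerLevel.translate · HodgeCM.Model.TowerLevel.translate_apply · HodgeCM.Model.TowerLevel.translate_of_mem · HodgeCM.Model.TowerLevel.translate_one · HodgeCM.Model.TowerLevel.translate_mul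 · HodgeCM.Model.TowerLevel.res_translate · HodgeCM.Model.TowerLevel.translate_restrictLevel) (`HOME/mc/pub-hodgecm-mc-binder-1-g16/stage62/HodgeCM/Model/TowerLevel.lean`, md5 593e8aa6c59f, 401 lines);
landed by the second packager p2 gen 13 (p2-g13) in gate run 62 as `HodgeCM/Model/TowerLevel.lean` (verbatim).
-/
/-
Copyright (c) 2026 the pub-hodgecm formalisation cell (harness21).  New file, not vendored.
Origin: session prover-pub-hodgecm-mc-binder-1-g16-0 (unit pub-hodgecm-mc-binder-1-g16, BINDER PROVER gen 16 of lineage mc-binder-1;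
content lane (J-Liu-Θ), (J3) design memo `HOME/mc/pub-hodgecm-mc-axioms-1-g15/J3-DESIGN.md` §3 + WORD TO binder-1 (STATUS 2026-08-20T19:56:33Z):
HECKE-TOWER sub-leaves (T1)–(T3) in the EQUIVARIANT-FAMILIES shape — the level-`K` carrier `H_K`), 2026-08-20.
-/
import Summits.HodgeConjecture.HodgeCM.Model.LevelTranslate
import Summits.HodgeConjecture.HodgeCM.Model.LevelConjugate

/-!
# The level-`K` carrier `H_K = H¹(X_K(ℂ); ℂ)` of the tower as `U(V)(L₀)`-equivariant families (no representatives)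

Fix the model universe `U = universeOf hHD hI hU h₃`, a hermitian space `(L, ι₁, V)` and a level `Γ = (Γ, K)` below a
conjugate of `K_f(3)` (`Γ.BelowConjThree`, `Model/LevelConjugate`).  The complex points of the level-`K` Shimura surface are
`X_K(ℂ) = U(V)(L₀) \ (𝔹 × U(V)(𝔸_f) / K) = ⊔_{[h]} Γ_h \ 𝔹`, `Γ_h = U(V)(L₀) ∩ hKh⁻¹` — in the universe, the component
of index `h ∈ U(V)(𝔸_f)` is the surface `P_h := U.pms L ι₁ V (Γ.conj h hΓ)` of the CONJUGATE LEVEL (#R106).  Instead of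
choosing representatives of the finite set `U(V)(L₀)\U(V)(𝔸_f)/K` (whose finiteness would be a citation), we take

* `towerLevel … Γ hΓ : Submodule ℂ (Π h, U.CohC (P_h) 1)` — the families `c` with
  `c h = t_γ^* (c h')` whenever `h' = (γ)_f h k` (`γ ∈ U(V)(L₀)`, `k ∈ K`; `Rel Γ γ h h'`), where
  `t_γ : P_h ⟶ P_{h'}` is the rational translate of `Model/LevelTranslate` (`Δ_h[v] ↦ Δ_{h'}[γ^{ι₁} v]`; it exists because
  `Γ_{h'} = γ Γ_h γ⁻¹`, `transCond_of_rel`).  The case `γ = 1` IS right-`K`-invariance, so no quotient by `K` is taken either.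

All identifications are pull-backs along chosen algebraic morphisms with prescribed complex points, and those compose
(`LevelTranslate.pullC_transMorU_comp`), so nothing depends on the choices.  API:

* `res : towerLevel →ₗ[ℂ] U.CohC (U.pms L ι₁ V Γ) 1` — restriction to the identity component (`c ↦ c 1` read on `P_Γ`
  through `t_1 : P_Γ ⟶ P_{Γ.conj 1}`, `Γ.conj 1 = Γ`);
* `restrictLevel : towerLevel Γ →ₗ towerLevel Γ'` for `Γ' ≤ Γ` (pull-back along the component coverings), functorial
  (`restrictLevel_refl/_trans`), with `res_restrictLevel : res (restrictLevel c) = (levelCover Γ Γ')^* (res c)`;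
* `translate g : towerLevel Γ →ₗ towerLevel (Γ.conj g)` — the action of `g ∈ U(V)(𝔸_f)` by re-indexing `(g • c) h = c (h g)`,
  with `translate_apply`, `K` acting trivially (`translate_of_mem`), `translate_mul`, `translate_one`, `res_translate`, and
  commutation with `restrictLevel`; level equalities are crossed by `castLevel` (`= t_1^*` componentwise, the identity in disguise).

(T4) (`H_{K'}^{K/K'} = H_K`, transfer) and the direct limit over `K` with its `ℂ[U(V)(𝔸_f)]`-module structure are the next leaves.
-/

noncomputable section

open scoped Matrix
open Matrix Function Set
open NumberField CategoryTheory
open Literature.AlgebraicGeometry.Motives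
open Literature.AlgebraicGeometry.ShimuraVarieties
open Literature.AlgebraicGeometry.HodgeTheory
open Literature.NumberTheory.Automorphic
open Literature.NumberTheory.Automorphic.PicardCM
open Literature.NumberTheory.Transcendental (Arapura2012_Cor_15_4_6)

namespace HodgeCM

namespace Model.TowerLevel

open HodgeCM.Model.LevelTranslate

variable (hHD : exists_isReal_hodgeModel) (hI : hodgePQ_independent_of_hodgeModel)
  (hU : BallQuotientUniformisedDatum) (h₃ : CMAbelianVarietyRealised) (hA : Arapura2012_Cor_15_4_6)
variable {L : CMField} {ι₁ : L →+* ℂ} {V : HermSpace3 L ι₁}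

/-! ## 0. Short names and the composition rule -/

/-- `U(V)(L₀) →* U(V)(𝔸_{L₀,f})`, `γ ↦ (γ)_f`. -/
abbrev ρ (V : HermSpace3 L ι₁) : ↥(Urat V) →* ↥V.adelicFin :=
  UnitaryGroup.rationalToFinAdelic (↥(maximalRealSubfield L)) L (IsCMField.complexConj L) 3 V.Hm

/-- `Hᵏ(X_Δ(ℂ); ℂ) = U.CohC (U.pms L ι₁ V Δ) k`. -/
abbrev Coh (Δ : Level V) (k : ℕ) : Type :=
  (universeOf hHD hI hU h₃).CohC ((universeOf hHD hI hU h₃).pms L ι₁ V Δ) k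

/-- The pull-back `t_γ^* : Hᵏ(X_{Δ₂}) → Hᵏ(X_{Δ₁})` along the rational translate `t_γ : X_{Δ₁} ⟶ X_{Δ₂}`. -/
abbrev trPull (γ : ↥(Urat V)) (Δ₁ Δ₂ : Level V) (ht : TransCond (γ : GL (Fin 3) L) Δ₁ Δ₂) (k : ℕ) :
    Coh hHD hI hU h₃ Δ₂ k →ₗ[ℂ] Coh hHD hI hU h₃ Δ₁ k :=
  (universeOf hHD hI hU h₃).pullC (transMorU hU h₃ hHD hI hA γ.2 Δ₁ Δ₂ ht) k

/-- **`t_{γ₁}^* (t_{γ₂}^* x) = t_{γ₃}^* x` whenever `γ₃ = γ₂ γ₁`** (any intermediate level, any condition proofs). -/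
theorem trPull_trPull {γ₁ γ₂ γ₃ : ↥(Urat V)} (e : γ₃ = γ₂ * γ₁) {Δ₁ Δ₂ Δ₃ : Level V}
    (ht₁ : TransCond (γ₁ : GL (Fin 3) L) Δ₁ Δ₂) (ht₂ : TransCond (γ₂ : GL (Fin 3) L) Δ₂ Δ₃)
    (ht₃ : TransCond (γ₃ : GL (Fin 3) L) Δ₁ Δ₃) (k : ℕ) (x : Coh hHD hI hU h₃ Δ₃ k) :
    trPull hHD hI hU h₃ hA γ₁ Δ₁ Δ₂ ht₁ k (trPull hHD hI hU h₃ hA γ₂ Δ₂ Δ₃ ht₂ k x) =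
      trPull hHD hI hU h₃ hA γ₃ Δ₁ Δ₃ ht₃ k x := by
  subst e
  exact pullC_transMorU_comp_apply hU h₃ hHD hI hA γ₁.2 γ₂.2 ht₁ ht₂ ht₃ k x

/-- `t_1^* = id` on one level. -/
theorem trPull_one_self {Δ : Level V} (ht : TransCond ((1 : ↥(Urat V)) : GL (Fin 3) L) Δ Δ) (k : ℕ)
    (x : Coh hHD hI hU h₃ Δ k) : trPull hHD hI hU h₃ hA 1 Δ Δ ht k x = x := by
  have := pullC_transMorU_one hU h₃ hHD hI hA (L := L) (ι₁ := ι₁) (V := V) (Δ := Δ) ht k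
  exact congrArg (fun f : Coh hHD hI hU h₃ Δ k →ₗ[ℂ] Coh hHD hI hU h₃ Δ k ↦ f x) this

/-- Crossing an equality of INDICES: `t_1^* (c h₁) = c h₂` for `h₁ = h₂` and any family `c` over `h ↦ Hᵏ(X_{Δ h})`. -/
theorem trPull_one_apply_of_eq {ι : Type} (Δ : ι → Level V) {k : ℕ} (c : Π i, Coh hHD hI hU h₃ (Δ i) k) {i₁ i₂ : ι}
    (e : i₁ = i₂) (ht : TransCond ((1 : ↥(Urat V)) : GL (Fin 3) L) (Δ i₂) (Δ i₁)) :
    trPull hHD hI hU h₃ hA 1 (Δ i₂) (Δ i₁) ht k (c i₁) = c i₂ := by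
  subst e; exact trPull_one_self hHD hI hU h₃ hA ht k _

/-- `TransCond 1 Δ₁ Δ₂` from an equality of levels. -/
theorem transCond_one_of_eq {Δ₁ Δ₂ : Level V} (e : Δ₁ = Δ₂) : TransCond ((1 : ↥(Urat V)) : GL (Fin 3) L) Δ₁ Δ₂ :=
  TransCond.one_of_le (e ▸ le_rfl)

/-- `TransCond 1 Δ' Δ` from `Δ' ≤ Δ` (the `K`-order). -/
theorem transCond_one_of_le {Δ Δ' : Level V} (h : Δ' ≤ Δ) : TransCond ((1 : ↥(Urat V)) : GL (Fin 3) L) Δ' Δ :=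
  TransCond.one_of_le (Level.Γ_mono h)

/-- `TransCond 1` then `TransCond γ` is `TransCond γ`. -/
theorem transCond_one_comp {γ : ↥(Urat V)} {Δ₁ Δ₂ Δ₃ : Level V} (h₁ : TransCond ((1 : ↥(Urat V)) : GL (Fin 3) L) Δ₁ Δ₂)
    (h₂ : TransCond (γ : GL (Fin 3) L) Δ₂ Δ₃) : TransCond (γ : GL (Fin 3) L) Δ₁ Δ₃ :=
  (h₁.comp h₂).congr_elt (mul_one _)

/-- `TransCond γ` then `TransCond 1` is `TransCond γ`. -/
theorem transCond_comp_one {γ : ↥(Urat V)} {Δ₁ Δ₂ Δ₃ : Level V} (h₁ : TransCond (γ : GL (Fin 3) L) Δ₁ Δ₂)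
    (h₂ : TransCond ((1 : ↥(Urat V)) : GL (Fin 3) L) Δ₂ Δ₃) : TransCond (γ : GL (Fin 3) L) Δ₁ Δ₃ :=
  (h₁.comp h₂).congr_elt (one_mul _)

/-! ## 1. The translation relation and the families -/

section Families

variable (Γ : Level V) (hΓ : Γ.BelowConjThree)

/-- **`h' ∈ (γ)_f h K`**: the index `h'` is the `γ`-translate of the index `h` (up to `K` on the right). -/
def Rel (γ : ↥(Urat V)) (h h' : V.adelicFin) : Prop := ∃ k ∈ Γ.K, h' = ρ V γ * h * k

variable {Γ}

/-- (Ported verbatim from the HodgeCMPerL package; no docstring in the source.) -/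
theorem Rel.one_of_mem {h k : V.adelicFin} (hk : k ∈ Γ.K) : Rel Γ 1 h (h * k) := ⟨k, hk, by simp⟩

/-- (Ported verbatim from the HodgeCMPerL package; no docstring in the source.) -/
theorem Rel.refl (h : V.adelicFin) : Rel Γ 1 h h := ⟨1, Γ.K.one_mem, by simp⟩

/-- (Ported verbatim from the HodgeCMPerL package; no docstring in the source.) -/
theorem Rel.self (γ : ↥(Urat V)) (h : V.adelicFin) : Rel Γ γ h (ρ V γ * h) := ⟨1, Γ.K.one_mem, by simp⟩

/-- (Ported verbatim from the HodgeCMPerL package; no docstring in the source.) -/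
theorem Rel.of_le {Γ' : Level V} (hle : Γ' ≤ Γ) {γ : ↥(Urat V)} {h h' : V.adelicFin} (r : Rel Γ' γ h h') : Rel Γ γ h h' := by
  obtain ⟨k, hk, rfl⟩ := r; exact ⟨k, Level.le_def.mp hle hk, rfl⟩

/-- **Along the relation the component levels are honest conjugates**: `Γ_{h'} = γ Γ_h γ⁻¹`. -/
theorem conj_Γ_eq_of_rel {γ : ↥(Urat V)} {h h' : V.adelicFin} (r : Rel Γ γ h h') :
    (Γ.conj h' hΓ).Γ = (Γ.conj h hΓ).Γ.map (MulAut.conj (γ : GL (Fin 3) L)).toMonoidHom := by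
  obtain ⟨k, hk, rfl⟩ := r
  rw [Level.conj_mul_of_mem Γ (ρ V γ * h) hk hΓ, Level.conj_mul Γ (ρ V γ) h hΓ]
  exact Level.Γ_conj_rationalToFinAdelic (Γ.conj h hΓ) (hΓ.conj h) γ

/-- Hence `γ` translates `Γ_h` into `Γ_{h'}`. -/
theorem transCond_of_rel {γ : ↥(Urat V)} {h h' : V.adelicFin} (r : Rel Γ γ h h') :
    TransCond (γ : GL (Fin 3) L) (Γ.conj h hΓ) (Γ.conj h' hΓ) :=
  TransCond.of_Γ_eq (conj_Γ_eq_of_rel hΓ r).symm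

variable (Γ)

/-- `H¹` of the component surface of index `h`, `P_h = U.pms L ι₁ V (Γ.conj h)`. -/
abbrev W (h : V.adelicFin) : Type := Coh hHD hI hU h₃ (Γ.conj h hΓ) 1

/-- **The level-`K` carrier `H_K = H¹(X_K(ℂ); ℂ)` as `U(V)(L₀)`-equivariant families over the components.** -/
def towerLevel : Submodule ℂ (Π h : V.adelicFin, W hHD hI hU h₃ Γ hΓ h) where
  carrier := {c | ∀ (γ : ↥(Urat V)) (h h' : V.adelicFin) (r : Rel Γ γ h h'),
    c h = trPull hHD hI hU h₃ hA γ (Γ.conj h hΓ) (Γ.conj h' hΓ) (transCond_of_rel hΓ r) 1 (c h')}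
  add_mem' {c d} hc hd γ h h' r := by rw [Pi.add_apply, Pi.add_apply, map_add, hc γ h h' r, hd γ h h' r]
  zero_mem' γ h h' r := by rw [Pi.zero_apply, Pi.zero_apply, map_zero]
  smul_mem' a {c} hc γ h h' r := by rw [Pi.smul_apply, Pi.smul_apply, map_smul, hc γ h h' r]

variable {Γ hΓ}

/-- (Ported verbatim from the HodgeCMPerL package; no docstring in the source.) -/
theorem mem_towerLevel_iff {c : Π h : V.adelicFin, W hHD hI hU h₃ Γ hΓ h} :
    c ∈ towerLevel hHD hI hU h₃ hA Γ hΓ ↔ ∀ (γ : ↥(Urat V)) (h h' : V.adelicFin) (r : Rel Γ γ h h'),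
      c h = trPull hHD hI hU h₃ hA γ (Γ.conj h hΓ) (Γ.conj h' hΓ) (transCond_of_rel hΓ r) 1 (c h') :=
  Iff.rfl

/-- The defining identity with an arbitrary `TransCond` proof. -/
theorem apply_eq_trPull (c : towerLevel hHD hI hU h₃ hA Γ hΓ) {γ : ↥(Urat V)} {h h' : V.adelicFin} (r : Rel Γ γ h h')
    (ht : TransCond (γ : GL (Fin 3) L) (Γ.conj h hΓ) (Γ.conj h' hΓ)) :
    (c : Π h, W hHD hI hU h₃ Γ hΓ h) h =
      trPull hHD hI hU h₃ hA γ (Γ.conj h hΓ) (Γ.conj h' hΓ) ht 1 ((c : Π h, W hHD hI hU h₃ Γ hΓ h) h') :=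
  c.2 γ h h' r

/-- **Right `K`-invariance** (`γ = 1`): `c h = t_1^* (c (h k))` for `k ∈ K`. -/
theorem apply_eq_of_mem (c : towerLevel hHD hI hU h₃ hA Γ hΓ) (h : V.adelicFin) {k : V.adelicFin} (hk : k ∈ Γ.K)
    (ht : TransCond ((1 : ↥(Urat V)) : GL (Fin 3) L) (Γ.conj h hΓ) (Γ.conj (h * k) hΓ)) :
    (c : Π h, W hHD hI hU h₃ Γ hΓ h) h = trPull hHD hI hU h₃ hA 1 (Γ.conj h hΓ) (Γ.conj (h * k) hΓ) ht 1
        ((c : Π h, W hHD hI hU h₃ Γ hΓ h) (h * k)) :=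
  c.2 1 h (h * k) (Rel.one_of_mem hk)

/-! ## 2. Restriction to the identity component -/

/-- **`res : H_K → H¹(P_Γ; ℂ)`** — the value at the index `1`, read on `P_Γ = U.pms L ι₁ V Γ` through
`t_1 : P_Γ ⟶ P_{Γ.conj 1}` (`Γ.conj 1 = Γ`). -/
def res : towerLevel hHD hI hU h₃ hA Γ hΓ →ₗ[ℂ] Coh hHD hI hU h₃ Γ 1 where
  toFun c := trPull hHD hI hU h₃ hA 1 Γ (Γ.conj 1 hΓ) (transCond_one_of_eq (Level.conj_one Γ hΓ).symm) 1
    ((c : Π h, W hHD hI hU h₃ Γ hΓ h) 1)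
  map_add' c d := by simp only [Submodule.coe_add, Pi.add_apply, map_add]
  map_smul' a c := by simp only [Submodule.coe_smul, Pi.smul_apply, map_smul, RingHom.id_apply]

/-- (Ported verbatim from the HodgeCMPerL package; no docstring in the source.) -/
theorem res_apply (c : towerLevel hHD hI hU h₃ hA Γ hΓ) :
    res hHD hI hU h₃ hA c = trPull hHD hI hU h₃ hA 1 Γ (Γ.conj 1 hΓ) (transCond_one_of_eq (Level.conj_one Γ hΓ).symm) 1
      ((c : Π h, W hHD hI hU h₃ Γ hΓ h) 1) := rfl

end Families

/-! ## 3. Change of level `Γ' ≤ Γ`: pull-back along the component coverings -/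

section Restrict

/-- Componentwise the levels are nested: `Γ'.conj h ≤ Γ.conj h`. -/
theorem transCond_conj_of_le {Γ Γ' : Level V} (hle : Γ' ≤ Γ) (hΓ : Γ.BelowConjThree) (hΓ' : Γ'.BelowConjThree)
    (h : V.adelicFin) : TransCond ((1 : ↥(Urat V)) : GL (Fin 3) L) (Γ'.conj h hΓ') (Γ.conj h hΓ) :=
  transCond_one_of_le (Level.conj_mono hle h hΓ hΓ')

/-- **`H_K → H_{K'}`** (`K' ≤ K`): pull back each component class along the covering `P'_h ⟶ P_h`. -/
def restrictLevel {Γ Γ' : Level V} (hle : Γ' ≤ Γ) (hΓ : Γ.BelowConjThree) (hΓ' : Γ'.BelowConjThree) :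
    towerLevel hHD hI hU h₃ hA Γ hΓ →ₗ[ℂ] towerLevel hHD hI hU h₃ hA Γ' hΓ' where
  toFun c := ⟨fun h ↦ trPull hHD hI hU h₃ hA 1 (Γ'.conj h hΓ') (Γ.conj h hΓ) (transCond_conj_of_le hle hΓ hΓ' h) 1
      ((c : Π h, W hHD hI hU h₃ Γ hΓ h) h), (mem_towerLevel_iff hHD hI hU h₃ hA).mpr <| by
    intro γ h h' r
    have ht : TransCond (γ : GL (Fin 3) L) (Γ'.conj h hΓ') (Γ.conj h' hΓ) :=
      transCond_one_comp (transCond_conj_of_le hle hΓ hΓ' h) (transCond_of_rel hΓ (r.of_le hle))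
    rw [apply_eq_trPull hHD hI hU h₃ hA c (r.of_le hle) (transCond_of_rel hΓ (r.of_le hle)),
      trPull_trPull hHD hI hU h₃ hA (mul_one γ).symm _ _ ht, trPull_trPull hHD hI hU h₃ hA (one_mul γ).symm _ _ ht]⟩
  map_add' c d := by ext h; simp only [Submodule.coe_add, Pi.add_apply, map_add]
  map_smul' a c := by ext h; simp only [Submodule.coe_smul, Pi.smul_apply, map_smul, RingHom.id_apply]

/-- (Ported verbatim from the HodgeCMPerL package; no docstring in the source.) -/
@[simp] theorem restrictLevel_apply {Γ Γ' : Level V} (hle : Γ' ≤ Γ) (hΓ : Γ.BelowConjThree) (hΓ' : Γ'.BelowConjThree)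
    (c : towerLevel hHD hI hU h₃ hA Γ hΓ) (h : V.adelicFin) :
    (restrictLevel hHD hI hU h₃ hA hle hΓ hΓ' c : Π h, W hHD hI hU h₃ Γ' hΓ' h) h =
      trPull hHD hI hU h₃ hA 1 (Γ'.conj h hΓ') (Γ.conj h hΓ) (transCond_conj_of_le hle hΓ hΓ' h) 1
        ((c : Π h, W hHD hI hU h₃ Γ hΓ h) h) := rfl

/-- **`res ∘ restrictLevel = levelCover^* ∘ res`**: on the identity component the change of level is the level covering
`X_{Γ'} ⟶ X_Γ` of `Model/CoverInstance`. -/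
theorem res_restrictLevel {Γ Γ' : Level V} (hle : Γ' ≤ Γ) (hΓ : Γ.BelowConjThree) (hΓ' : Γ'.BelowConjThree)
    (c : towerLevel hHD hI hU h₃ hA Γ hΓ) :
    res hHD hI hU h₃ hA (restrictLevel hHD hI hU h₃ hA hle hΓ hΓ' c) =
      (universeOf hHD hI hU h₃).pullC (X := (universeOf hHD hI hU h₃).pms L ι₁ V Γ')
        (Y := (universeOf hHD hI hU h₃).pms L ι₁ V Γ) (levelCover hU h₃ hHD hA Γ Γ' (Level.Γ_mono hle)) 1
        (res hHD hI hU h₃ hA c) := by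
  rw [res_apply, res_apply, restrictLevel_apply, pullC_levelCover_eq hU h₃ hHD hI hA (Level.Γ_mono hle) 1]
  have ht : TransCond ((1 : ↥(Urat V)) : GL (Fin 3) L) Γ' (Γ.conj 1 hΓ) :=
    (transCond_one_of_le (V := V) hle).one_trans (transCond_one_of_eq (Level.conj_one Γ hΓ).symm)
  rw [trPull_trPull hHD hI hU h₃ hA (mul_one 1).symm _ _ ht]
  exact (trPull_trPull hHD hI hU h₃ hA (mul_one 1).symm (transCond_one_of_le hle) _ ht 1 _).symm

/-- `restrictLevel` at `Γ' = Γ` is the identity. -/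
theorem restrictLevel_refl {Γ : Level V} (hΓ : Γ.BelowConjThree) (c : towerLevel hHD hI hU h₃ hA Γ hΓ) :
    restrictLevel hHD hI hU h₃ hA (le_refl Γ) hΓ hΓ c = c := by
  apply Subtype.ext; funext h
  rw [restrictLevel_apply, trPull_one_self]

/-- `restrictLevel` is transitive: `Γ'' ≤ Γ' ≤ Γ`. -/
theorem restrictLevel_trans {Γ Γ' Γ'' : Level V} (hle : Γ' ≤ Γ) (hle' : Γ'' ≤ Γ') (hΓ : Γ.BelowConjThree)
    (hΓ' : Γ'.BelowConjThree) (hΓ'' : Γ''.BelowConjThree) (c : towerLevel hHD hI hU h₃ hA Γ hΓ) :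
    restrictLevel hHD hI hU h₃ hA hle' hΓ' hΓ'' (restrictLevel hHD hI hU h₃ hA hle hΓ hΓ' c) =
      restrictLevel hHD hI hU h₃ hA (hle'.trans hle) hΓ hΓ'' c := by
  apply Subtype.ext; funext h
  simp only [restrictLevel_apply]
  exact trPull_trPull hHD hI hU h₃ hA (mul_one 1).symm _ _ _ 1 _

end Restrict

/-! ## 4. Crossing an equality of levels -/

section Cast

/-- For EQUAL levels `Γ₁ = Γ₂` (e.g. `Γ.conj (g g') = (Γ.conj g').conj g`, `Γ.conj 1 = Γ`, `Γ.conj k = Γ`), the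
identification `H_{K₁} → H_{K₂}` — componentwise `t_1^*`, i.e. the identity read through the chosen morphisms; this avoids
transporting classes along type equalities. -/
def castLevel {Γ₁ Γ₂ : Level V} (e : Γ₁ = Γ₂) (hΓ₁ : Γ₁.BelowConjThree) (hΓ₂ : Γ₂.BelowConjThree) :
    towerLevel hHD hI hU h₃ hA Γ₁ hΓ₁ →ₗ[ℂ] towerLevel hHD hI hU h₃ hA Γ₂ hΓ₂ :=
  restrictLevel hHD hI hU h₃ hA e.symm.le hΓ₁ hΓ₂

/-- (Ported verbatim from the HodgeCMPerL package; no docstring in the source.) -/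
theorem castLevel_apply {Γ₁ Γ₂ : Level V} (e : Γ₁ = Γ₂) (hΓ₁ : Γ₁.BelowConjThree) (hΓ₂ : Γ₂.BelowConjThree)
    (c : towerLevel hHD hI hU h₃ hA Γ₁ hΓ₁) (h : V.adelicFin) :
    (castLevel hHD hI hU h₃ hA e hΓ₁ hΓ₂ c : Π h, W hHD hI hU h₃ Γ₂ hΓ₂ h) h =
      trPull hHD hI hU h₃ hA 1 (Γ₂.conj h hΓ₂) (Γ₁.conj h hΓ₁) (transCond_conj_of_le e.symm.le hΓ₁ hΓ₂ h) 1
        ((c : Π h, W hHD hI hU h₃ Γ₁ hΓ₁ h) h) := rfl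

/-- `castLevel` along `rfl` is the identity. -/
theorem castLevel_rfl {Γ₁ : Level V} (hΓ₁ hΓ₁' : Γ₁.BelowConjThree) (c : towerLevel hHD hI hU h₃ hA Γ₁ hΓ₁) :
    castLevel hHD hI hU h₃ hA rfl hΓ₁ hΓ₁' c = c := restrictLevel_refl hHD hI hU h₃ hA hΓ₁ c

/-- `castLevel` there and back is the identity. -/
theorem castLevel_castLevel_symm {Γ₁ Γ₂ : Level V} (e : Γ₁ = Γ₂) (hΓ₁ : Γ₁.BelowConjThree) (hΓ₂ : Γ₂.BelowConjThree)
    (c : towerLevel hHD hI hU h₃ hA Γ₁ hΓ₁) :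
    castLevel hHD hI hU h₃ hA e.symm hΓ₂ hΓ₁ (castLevel hHD hI hU h₃ hA e hΓ₁ hΓ₂ c) = c := by
  subst e; rw [castLevel_rfl, castLevel_rfl]

/-- `castLevel` composes. -/
theorem castLevel_trans {Γ₁ Γ₂ Γ₃ : Level V} (e : Γ₁ = Γ₂) (e' : Γ₂ = Γ₃) (hΓ₁ : Γ₁.BelowConjThree)
    (hΓ₂ : Γ₂.BelowConjThree) (hΓ₃ : Γ₃.BelowConjThree) (c : towerLevel hHD hI hU h₃ hA Γ₁ hΓ₁) :
    castLevel hHD hI hU h₃ hA e' hΓ₂ hΓ₃ (castLevel hHD hI hU h₃ hA e hΓ₁ hΓ₂ c) = castLevel hHD hI hU h₃ hA (e.trans e') hΓ₁ hΓ₃ c :=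
  restrictLevel_trans hHD hI hU h₃ hA _ _ _ _ _ c

end Cast

/-! ## 5. The action of `U(V)(𝔸_f)` by re-indexing -/

section Translate

/-- Along `(Γ.conj g).K = gKg⁻¹`: the relation at level `Γ.conj g` is the relation at level `Γ` after right
multiplication by `g`. -/
theorem rel_mul_of_rel_conj {Γ : Level V} (hΓ : Γ.BelowConjThree) (g : V.adelicFin) {γ : ↥(Urat V)} {h h' : V.adelicFin}
    (r : Rel (Γ.conj g hΓ) γ h h') : Rel Γ γ (h * g) (h' * g) := by
  obtain ⟨k', hk', rfl⟩ := r
  obtain ⟨k, hk, rfl⟩ := Level.mem_conjK_iff.mp hk'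
  exact ⟨k, hk, by group⟩

/-- The index transport `((Γ.conj g).conj h) = Γ.conj (h g)` as a `TransCond 1`. -/
theorem transCond_conj_conj {Γ : Level V} (hΓ : Γ.BelowConjThree) (g h : V.adelicFin) :
    TransCond ((1 : ↥(Urat V)) : GL (Fin 3) L) ((Γ.conj g hΓ).conj h (hΓ.conj g)) (Γ.conj (h * g) hΓ) :=
  transCond_one_of_eq (Level.conj_mul Γ h g hΓ).symm

/-- **`translate g : H_K → H_{gKg⁻¹}`, `(g • c) h = c (h g)`** (read on `P_{(Γ.conj g).conj h}` through
`t_1 : P_{(Γ.conj g).conj h} ⟶ P_{Γ.conj (h g)}`, the two levels being equal by `Level.conj_mul`). -/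
def translate {Γ : Level V} (hΓ : Γ.BelowConjThree) (g : V.adelicFin) :
    towerLevel hHD hI hU h₃ hA Γ hΓ →ₗ[ℂ] towerLevel hHD hI hU h₃ hA (Γ.conj g hΓ) (hΓ.conj g) where
  toFun c := ⟨fun h ↦ trPull hHD hI hU h₃ hA 1 ((Γ.conj g hΓ).conj h (hΓ.conj g)) (Γ.conj (h * g) hΓ)
      (transCond_conj_conj hΓ g h) 1 ((c : Π h, W hHD hI hU h₃ Γ hΓ h) (h * g)),
      (mem_towerLevel_iff hHD hI hU h₃ hA).mpr <| by
    intro γ h h' r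
    have r₀ := rel_mul_of_rel_conj hΓ g r
    have ht : TransCond (γ : GL (Fin 3) L) ((Γ.conj g hΓ).conj h (hΓ.conj g)) (Γ.conj (h' * g) hΓ) :=
      transCond_one_comp (transCond_conj_conj hΓ g h) (transCond_of_rel hΓ r₀)
    rw [apply_eq_trPull hHD hI hU h₃ hA c r₀ (transCond_of_rel hΓ r₀),
      trPull_trPull hHD hI hU h₃ hA (mul_one γ).symm _ _ ht, trPull_trPull hHD hI hU h₃ hA (one_mul γ).symm _ _ ht]⟩
  map_add' c d := by ext h; simp only [Submodule.coe_add, Pi.add_apply, map_add]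
  map_smul' a c := by ext h; simp only [Submodule.coe_smul, Pi.smul_apply, map_smul, RingHom.id_apply]

/-- (Ported verbatim from the HodgeCMPerL package; no docstring in the source.) -/
@[simp] theorem translate_apply {Γ : Level V} (hΓ : Γ.BelowConjThree) (g : V.adelicFin) (c : towerLevel hHD hI hU h₃ hA Γ hΓ)
    (h : V.adelicFin) :
    (translate hHD hI hU h₃ hA hΓ g c : Π h, W hHD hI hU h₃ (Γ.conj g hΓ) (hΓ.conj g) h) h =
      trPull hHD hI hU h₃ hA 1 ((Γ.conj g hΓ).conj h (hΓ.conj g)) (Γ.conj (h * g) hΓ) (transCond_conj_conj hΓ g h) 1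
        ((c : Π h, W hHD hI hU h₃ Γ hΓ h) (h * g)) := rfl

/-- **`K` acts trivially on `H_K`**: for `k ∈ K`, `translate k` is the identity (read through `Γ.conj k = Γ`). -/
theorem translate_of_mem {Γ : Level V} (hΓ : Γ.BelowConjThree) {k : V.adelicFin} (hk : k ∈ Γ.K)
    (c : towerLevel hHD hI hU h₃ hA Γ hΓ) :
    castLevel hHD hI hU h₃ hA (Level.conj_of_mem Γ hk hΓ) (hΓ.conj k) hΓ (translate hHD hI hU h₃ hA hΓ k c) = c := by
  apply Subtype.ext; funext h
  have ht : TransCond ((1 : ↥(Urat V)) : GL (Fin 3) L) (Γ.conj h hΓ) (Γ.conj (h * k) hΓ) :=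
    (transCond_conj_of_le (Level.conj_of_mem Γ hk hΓ).symm.le (hΓ.conj k) hΓ h).one_trans (transCond_conj_conj hΓ k h)
  rw [castLevel_apply, translate_apply, apply_eq_of_mem hHD hI hU h₃ hA c h hk ht]
  exact trPull_trPull hHD hI hU h₃ hA (mul_one 1).symm _ _ ht 1 _

/-- **`translate 1 = id`** (read through `Γ.conj 1 = Γ`). -/
theorem translate_one {Γ : Level V} (hΓ : Γ.BelowConjThree) (c : towerLevel hHD hI hU h₃ hA Γ hΓ) :
    castLevel hHD hI hU h₃ hA (Level.conj_one Γ hΓ) (hΓ.conj 1) hΓ (translate hHD hI hU h₃ hA hΓ 1 c) = c := by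
  apply Subtype.ext; funext h
  have ht : TransCond ((1 : ↥(Urat V)) : GL (Fin 3) L) (Γ.conj h hΓ) (Γ.conj (h * 1) hΓ) :=
    (transCond_conj_of_le (Level.conj_one Γ hΓ).symm.le (hΓ.conj 1) hΓ h).one_trans (transCond_conj_conj hΓ 1 h)
  rw [castLevel_apply, translate_apply, trPull_trPull hHD hI hU h₃ hA (mul_one 1).symm _ _ ht]
  exact trPull_one_apply_of_eq hHD hI hU h₃ hA (fun i ↦ Γ.conj i hΓ) (c : Π h, W hHD hI hU h₃ Γ hΓ h) (mul_one h) ht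

/-- **`translate (g g') = translate g ∘ translate g'`** (read through `Γ.conj (g g') = (Γ.conj g').conj g`). -/
theorem translate_mul {Γ : Level V} (hΓ : Γ.BelowConjThree) (g g' : V.adelicFin) (c : towerLevel hHD hI hU h₃ hA Γ hΓ) :
    castLevel hHD hI hU h₃ hA (Level.conj_mul Γ g g' hΓ) (hΓ.conj (g * g')) ((hΓ.conj g').conj g)
        (translate hHD hI hU h₃ hA hΓ (g * g') c) =
      translate hHD hI hU h₃ hA (hΓ.conj g') g (translate hHD hI hU h₃ hA hΓ g' c) := by
  apply Subtype.ext; funext h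
  have htL : TransCond ((1 : ↥(Urat V)) : GL (Fin 3) L) (((Γ.conj g' hΓ).conj g (hΓ.conj g')).conj h ((hΓ.conj g').conj g))
      (Γ.conj (h * (g * g')) hΓ) :=
    (transCond_conj_of_le (Level.conj_mul Γ g g' hΓ).symm.le (hΓ.conj (g * g')) ((hΓ.conj g').conj g) h).one_trans
      (transCond_conj_conj hΓ (g * g') h)
  have htR : TransCond ((1 : ↥(Urat V)) : GL (Fin 3) L) (((Γ.conj g' hΓ).conj g (hΓ.conj g')).conj h ((hΓ.conj g').conj g))
      (Γ.conj (h * g * g') hΓ) :=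
    (transCond_conj_conj (hΓ.conj g') g h).one_trans (transCond_conj_conj hΓ g' (h * g))
  rw [castLevel_apply, translate_apply, translate_apply, translate_apply,
    trPull_trPull hHD hI hU h₃ hA (mul_one 1).symm _ _ htL, trPull_trPull hHD hI hU h₃ hA (mul_one 1).symm _ _ htR]
  -- both sides are `t_1^*` of `c` at the indices `h (g g')` and `(h g) g'`
  have key : ∀ (i₁ i₂ : V.adelicFin) (e : i₁ = i₂)
      (ht₁ : TransCond ((1 : ↥(Urat V)) : GL (Fin 3) L) (((Γ.conj g' hΓ).conj g (hΓ.conj g')).conj h ((hΓ.conj g').conj g))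
        (Γ.conj i₁ hΓ))
      (ht₂ : TransCond ((1 : ↥(Urat V)) : GL (Fin 3) L) (((Γ.conj g' hΓ).conj g (hΓ.conj g')).conj h ((hΓ.conj g').conj g))
        (Γ.conj i₂ hΓ)),
      trPull hHD hI hU h₃ hA 1 _ _ ht₁ 1 ((c : Π h, W hHD hI hU h₃ Γ hΓ h) i₁) =
        trPull hHD hI hU h₃ hA 1 _ _ ht₂ 1 ((c : Π h, W hHD hI hU h₃ Γ hΓ h) i₂) := by
    intro i₁ i₂ e ht₁ ht₂; subst e; rfl
  exact key (h * (g * g')) (h * g * g') (mul_assoc h g g').symm htL htR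


-- port_pkg: scope closed for this part
end Translate
end Model.TowerLevel
end HodgeCM
end
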